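import Summits.QuantumFields.YangMills.Theorems.BalabanUVNodesStage0FlatWitness
import Literature.MathematicalPhysics.QuantumFieldTheory.Balaban1983to89.T4ContinuumYM4Torus

/-!
# A THIRD labelled placeholder in `FiniteEpsData F G`: the STEERED datum — (B) and endpoint existence hold trivially AND the
# tuned bare-coupling sequences are PRESCRIBED: `D.Tuned γ g g₀ ↔ ∀ K, g₀ K = g · x K` for any antitone profile `x`, `x 0 = 1`
# Kernel form of «at Stage 0 the spine's content is posed along a coupling trajectory of the prover's choosing»

Scope: YM-PLAN Track A bookkeeping (pub-ymgap seat `dag-n23-b`, node N23 = binder B1; tree home of the detail route «BalabanUVNodes»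
per chair R424; filed `--supports stmt-QuantumFields-19182`, the route's crux `SpineGivenEndpoint`; bears on the spine leaf
`BalabanLadder.UV`, item stmt-QuantumFields-19351).  Bookkeeping ∕ typing only; NO analytic content of the series is proved or asserted;
nothing of Bałaban's is used.  HONEST FRAMING — READ FIRST: like `BalabanUVNodesStage0FlatWitness` (the FLAT datum, at which (B) and
endpoint existence hold trivially) this module builds a JUNK inhabitant of the data type, labelled field by field; it differs from the
flat datum in ONE field — the coupling FLOW — and its purpose is again NEGATIVE INFORMATION about typed statements: it certifies in the
kernel that the NODE 00 Stage-0 record predicate `Node00.IsDatumOfRecord₀` (which pins `D.av` only) lets an admissible datum PRESCRIBE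
its own tuned bare-coupling sequences, so that every statement of the form «∃ D of record (Stage 0), (B) ∧ END ∧ `HybridNE7Under D END`»
(at `N = 2`: the matrix of the spine leaf `…BalabanLadder.UV F` and the conclusion of `…BalabanUVNodes.SpineGivenEndpoint F`) FOLLOWS
from per-string hybrid-NE7 data for the family's Wilson scheme of record along bare couplings `g · x_K` with `x` ANY antitone profile
(`exists_isDatumOfRecord₀_B_end_hybrid_of_steer`) — e.g. `x_K` decaying as fast as one likes, i.e. inverse couplings `β_K = (g x_K)⁻²`
growing arbitrarily fast relative to the torus `F.P K`, which is NOT Bałaban's asymptotically-free tuning ([Balaban1987RG1] Thm 2,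
(0.31): `1∕g_K² ≈ 1∕g² + β log L^K`).  One finite four-torus programme at fixed `ε`; nothing about the continuum limit on `ℝ⁴`,
infinite volume, OS axioms, a mass gap or the Clay problem.

## The steered datum (every field labelled; `x : ℕ → ℝ` the steer)
* `av` = the GIVEN averagings (at `Node00.avOfRecord F N`: a datum of record, Stage 0, by `rfl`);
* construction `steerConstruction x`: flow `g_k := g₀ ∕ x_k` of the run with bare coupling `g₀` (for antitone `x` with `x 0 = 1` the
  coupling GROWS along the run and starts at `g₀`), displayed one-variable β-functions `β_{k+1}(y) := (1 − (x_{k+1}∕x_k)²)∕y²`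
  (`steerBeta1`), which ARE the history-dependent family `steerHBeta x` curried (`curriesHBeta_steer`) and generate the flow FORWARD by
  the recursion (0.20) `1∕g_{k+1}² = 1∕g_k² − β_{k+1}(g_k)` (`forwardGenerated_steer`) — so the datum's fields `curries`, `fwd` hold
  honestly for a JUNK β; every other field as in the flat datum: gauge fields as configurations, the flat tower `ρ₀ = e^{−A∕g₀²}`,
  `ρ_k ≡ Z_ε` (k ≥ 1), `χ ≡ 0`, `numSites ≡ 0`, zero actions, `Repr ∕ IndAss ∕ Sect2Form :≡ True`;
* realisation: identity dictionary, honest Radon–Nikodym transport `T`, large-field operation `R :=` flattening (integral-preserving).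

## What holds at it, AS TYPED (§3–§4)
(B) pinned (`endStatementBPrinted_steer`), `DagBinding.EndpointExistence` (`endpointExistence_steer`: the run from `g₀ := g·x_K` stays in
`]0, γ]` and ends at `g`), and the CHARACTERISATION OF THE TUNED SEQUENCES `tuned_steer_iff`: for `0 < g ≤ γ`,
`D.Tuned γ g g₀ ↔ ∀ K, g₀ K = g · x K`.  Consequently (§4) the spine slot `T4ApexHybrid.HybridNE7Under D H` at the steered datum of record
UNFOLDS to «`H →` for all small `γ`, `g ≤ γ`: `StringwiseHybridNE7` of the Wilson scheme of record at bare couplings `g · x_K`»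
(`hybridNE7Under_steer_iff`), the scheme being the same as every Stage-0 datum's (`scheme_steerDatumSU_eq`); and the UV-face follows from
that hybrid-NE7 hypothesis alone (`exists_isDatumOfRecord₀_B_end_hybrid_of_steer`).  The flat datum is the steer `x ≡ 1`.

## Reading, for the planner ∕ spine owner ∕ NODE 00 (why the FLOW must be pinned)
Pinning the construction's clause fields, `χ` and `R` (the repair of items 19183 ∕ 19181) does not touch this device: `Tuned`, `EndpointExistence`
and the scheme's `β_K` read ONLY `flow.g`, which `ForwardGenerated` ∕ `CurriesHBeta` tie to the datum's OWN `βfun` — free at Stage 0.  The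
spine's content (matching of consecutive Wilson schemes along the tuned couplings) is Bałaban's only when `βfun` is Bałaban's
([Balaban1987RG1] (1.20)–(1.22)); a record predicate for the spine leaf must pin it (or at least the (0.31) log-running of the tuned runs,
which no steer with `x_K⁻² ≫ K log L` satisfies — cf. `BalabanUVNodesStage0FlatWitness.not_logRunning_flat` for the constant steer).
This module proves nothing about which repair is chosen.
-/

noncomputable section

open MeasureTheory

namespace Summit.QuantumFields.YangMills.Theorems.BalabanUVNodesStage0SteeredWitness

open Literature.MathematicalPhysics.QuantumFieldTheory.Balaban1983to89
open Literature.MathematicalPhysics.QuantumFieldTheory.Balaban1983to89.Missing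
open Literature.MathematicalPhysics.QuantumFieldTheory.Balaban1983to89.AveragingRT
open Literature.MathematicalPhysics.QuantumFieldTheory.Balaban1983to89.T4Continuum
open Literature.MathematicalPhysics.QuantumFieldTheory.Balaban1983to89.T4FiniteEpsInhabited
open Summit.QuantumFields.YangMills.Theorems.BalabanUVNodesStage0FlatWitness

/-! ## 1. The steered flow and its β-functions -/

section Flow

variable (x : ℕ → ℝ)

/-- The steered HISTORY-DEPENDENT β-functions `β_{k+1}(g_0, …, g_k) := (1 − (x_{k+1}∕x_k)²) ∕ g_k²` — a JUNK family (no relation to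
[Balaban1987RG1] (1.20)–(1.22)) chosen so that the recursion (0.20) produces the flow `g_k = g₀ ∕ x_k`. [folklore] -/
def steerHBeta : FlowStep.HBeta := fun k v => (1 - (x (k + 1) / x k) ^ 2) / (v (Fin.last k)) ^ 2

/-- The run's displayed one-variable β-functions (the steered family with the run's own history plugged in; `β_0` unused). [folklore] -/
def steerBeta1 : ℕ → ℝ → ℝ
  | 0 => fun _ => 0
  | k + 1 => fun y => (1 - (x (k + 1) / x k) ^ 2) / y ^ 2

/-- Unfolding: the steered β at the prefix of a coupling sequence reads its last entry only. [folklore] -/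
theorem steerHBeta_prefixOf (g : ℕ → ℝ) (k : ℕ) :
    steerHBeta x k (FlowStep.prefixOf g k) = (1 - (x (k + 1) / x k) ^ 2) / (g k) ^ 2 := rfl

end Flow

/-! ## 2. The steered construction, its honest forward generation, its realisation, the steered datum -/

section Construction

variable (F : T4Family) (G : Type) [GaugeGroup G] [MeasurableSpace G] [HaarData G] (x : ℕ → ℝ)
  (av : (K j : ℕ) → Averaging (F.P K) j G)

/-- THE STEERED CONSTRUCTION (JUNK, every field labelled in the module docstring): flow `g_k := g₀ ∕ x_k` with the steered β-functions;
everything else as in the flat construction (gauge fields as configurations, flat tower as densities, `χ ≡ 0`, `numSites ≡ 0`, zero actions,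
`Repr ∕ IndAss ∕ Sect2Form :≡ True`).  Asserts NONE of Bałaban's representations. [folklore] -/
def steerConstruction : B16.Construction := fun p =>
  { flow := ⟨fun k => p.g0 / x k, steerBeta1 x⟩
    Cfg := fun k => GaugeField (F.P p.K) k G
    dom := fun _ => Set.univ
    effAction := fun _ _ => 0
    wilsonBG := fun _ _ => 0
    Ek := fun _ _ => 0
    numSites := fun _ => 0
    Repr := fun _ => True
    IndAss := fun _ => True
    ρ := fun k => flatTower F G p.K p.g0 k
    χ := fun _ _ => 0
    Sect2Form := fun _ => True }

/-- The flow of the run with bare coupling `g₀` is `g_k = g₀ ∕ x_k` (`rfl`). [folklore] -/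
theorem steer_flow_g (p : B12.RunParams) (k : ℕ) : ((steerConstruction F G x).toB12 p).flow.g k = p.g0 / x k := rfl

/-- The steered construction's one-variable β-functions ARE the steered history-dependent family curried
(`DagBinding.CurriesHBeta`): both sides read only the substituted last entry. [folklore] -/
theorem curriesHBeta_steer : DagBinding.CurriesHBeta (steerConstruction F G x).toB12 (steerHBeta x) := by
  intro p j y _
  show steerBeta1 x (j + 1) y = (1 - (x (j + 1) / x j) ^ 2) /
    (Function.update (FlowStep.prefixOf ((steerConstruction F G x).toB12 p).flow.g j) (Fin.last j) y (Fin.last j)) ^ 2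
  rw [Function.update_self]
  rfl

/-- **The steered flow IS generated forward from the bare coupling by the steered β-functions** ([Balaban1987RG1] (0.20) as typed,
`DagBinding.ForwardGenerated`): `g_0 = g₀` (needs `x 0 = 1`) and `1∕g_{k+1}² = 1∕g_k² − β_{k+1}(g_0, …, g_k)` with `g_{k+1} > 0` (needs
`x > 0`).  So the datum's β-bookkeeping fields hold HONESTLY for a junk β. [folklore] -/
theorem forwardGenerated_steer (hx0 : x 0 = 1) (hxpos : ∀ k, 0 < x k) :
    DagBinding.ForwardGenerated (steerConstruction F G x).toB12 (steerHBeta x) := by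
  refine ⟨fun p => ?_, fun p k _ hpos _ => ?_⟩
  · rw [steer_flow_g, hx0, div_one]
  · have h0 : 0 < p.g0 := by
      have := hpos 0 (Nat.zero_le _)
      rwa [steer_flow_g, hx0, div_one] at this
    have hxk := (hxpos k).ne'
    have hxk1 := (hxpos (k + 1)).ne'
    simp only [steer_flow_g, steerHBeta_prefixOf]
    refine ⟨div_pos h0 (hxpos (k + 1)), ?_⟩
    field_simp
    ring

/-- `χ_k ≥ 0` holds (with `χ ≡ 0`). [folklore] -/
theorem signConventions_steer : B16.SignConventions (steerConstruction F G x) := fun _ _ _ => le_rfl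

variable [RegularGaugeGroup G]

/-- THE STEERED REALISATION along the given averagings: identity dictionary, `ρ₀` = the Boltzmann weight (`c = 1`), honest Radon–Nikodym
transport along `av K k` (`Setup.IsRT` for `k < K` under measurability + `HaarAC`), `R :=` flattening (junk; (0.4) holds), `ρ_{k+1} = R(Tρ_k)`
because `∫Tρ_k = ∫ρ_k = Z_ε` — verbatim the flat realisation (the densities do not read the flow). [folklore] -/
def steerRealisation (hmeas : ∀ K j, Measurable (av K j).avg) (hac : ∀ K k, k < K → HaarAC (av K k).avg) :
    Realisation F G (steerConstruction F G x) av where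
  cfg := fun _ _ _ => Equiv.refl _
  rho_zero := fun _ _ => ⟨1, one_pos, fun _ => (one_mul _).symm⟩
  Trho := fun K g₀ k => rnTransport (av K k).avg (flatTower F G K g₀ k)
  isRT_Trho := fun K g₀ k hk =>
    isRT_rnTransport_of_ac _ (hmeas K k) (hac K k hk) _ (integrable_flatTower F G K g₀ k)
  R := fun _ _ _ => flatten
  preservesIntegral_R := fun _ _ _ _ => preservesIntegral_flatten
  rho_succ_eq := fun K g₀ k hk => by
    funext V
    show partitionFn (G := G) (F.P K) (g₀⁻¹ ^ 2) =
      ∫ W, rnTransport (av K k).avg (flatTower F G K g₀ k) W ∂fieldMeasure (F.P K) (k + 1) G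
    have h := isRT_rnTransport_of_ac _ (hmeas K k) (hac K k hk) _ (integrable_flatTower F G K g₀ k)
      (fun _ => (1 : ℝ)) measurable_const ⟨1, fun _ => by simp⟩
    simp only [mul_one] at h
    rw [h, integral_flatTower]

/-- THE STEERED DATUM (for a steer with `x 0 = 1`, `x > 0`): finite-`ε` data with the GIVEN averagings on the steered construction —
a labelled JUNK inhabitant of `FiniteEpsData F G`. [folklore] -/
def steerData (hx0 : x 0 = 1) (hxpos : ∀ k, 0 < x k) (hmeas : ∀ K j, Measurable (av K j).avg)
    (hac : ∀ K k, k < K → HaarAC (av K k).avg) : FiniteEpsData F G where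
  C := steerConstruction F G x
  βfun := steerHBeta x
  curries := curriesHBeta_steer F G x
  fwd := forwardGenerated_steer F G x hx0 hxpos
  av := av
  real := steerRealisation F G x av hmeas hac

end Construction

/-! ## 3. What holds at the steered construction, AS TYPED — and the tuned sequences -/

section JunkTrue

variable (F : T4Family) (G : Type) [GaugeGroup G] [MeasurableSpace G] [HaarData G] (x : ℕ → ℝ)

/-- A steered run: from `g₀ = g · x_K` the coupling at step `k ≤ K` is `g · x_K ∕ x_k ∈ ]0, g]` for an antitone positive steer. [folklore] -/
theorem steer_run_mem (hxpos : ∀ k, 0 < x k) (hanti : Antitone x) {g : ℝ} (hg : 0 < g) {K k : ℕ} (hk : k ≤ K) :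
    0 < g * x K / x k ∧ g * x K / x k ≤ g := by
  refine ⟨div_pos (mul_pos hg (hxpos K)) (hxpos k), ?_⟩
  rw [div_le_iff₀ (hxpos k)]
  exact mul_le_mul_of_nonneg_left (hanti hk) hg.le

/-- **ENDPOINT EXISTENCE AS TYPED HOLDS AT THE STEERED CONSTRUCTION** (`DagBinding.EndpointExistence`, the endpoint half of [Balaban1987RG1]
Thm 2 p. 259 as typed): for every `m`, `γ ≤ 1`, `g ≤ γ` and `K`, the run from `g₀ := g · x_K` stays in `]0, γ]` and ends at `g_K = g`. [folklore] -/
theorem endpointExistence_steer (hxpos : ∀ k, 0 < x k) (hanti : Antitone x) :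
    DagBinding.EndpointExistence (steerConstruction F G x).toB12 := fun _ =>
  ⟨1, one_pos, fun γ hγ _ => ⟨γ, hγ, fun g hg hgγ K => ⟨g * x K, fun k hk => by
    rw [steer_flow_g]
    exact ⟨(steer_run_mem x hxpos hanti hg hk).1, (steer_run_mem x hxpos hanti hg hk).2.trans hgγ⟩, by
    rw [steer_flow_g]
    exact mul_div_cancel_right₀ g (hxpos K).ne'⟩⟩⟩

/-- [Balaban1989LargeFieldII] Thm 1 AS TYPED holds at the steered construction (`Sect2Form :≡ True`). [folklore] -/
theorem thm1Printed_steer : B16.Thm1Printed (steerConstruction F G x) :=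
  ⟨1, one_pos, fun _ _ _ _ => trivial⟩

variable [RegularGaugeGroup G]

/-- [Balaban1988Convergent] Cor. 3 (2.50) AS TYPED holds at the steered construction with `e₋ = e₊ ≡ 0` (`χ ≡ 0`; `0 ≤ ρ_k ≤ 1`) — the flow
enters `UVIneq` only behind the factor `χ = 0`. [folklore] -/
theorem cor3_250_steer : B16.Cor3_250 (steerConstruction F G x) := by
  refine ⟨1, one_pos, fun _ => 0, fun _ => 0, fun P _ k _ V => ⟨?_, ?_⟩⟩
  · show (0 : ℝ) * _ ≤ flatTower F G P.K P.g0 k V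
    rw [zero_mul]
    exact flatTower_nonneg F G P.K P.g0 k V
  · show flatTower F G P.K P.g0 k V ≤ Real.exp (0 * ((0 : ℕ) : ℝ))
    rw [zero_mul, Real.exp_zero]
    exact flatTower_le_one F G P.K P.g0 k V

/-- **(B) PINNED AS TYPED HOLDS AT THE STEERED CONSTRUCTION.** [folklore] -/
theorem endStatementBPrinted_steer : B16.EndStatementBPrinted (steerConstruction F G x) :=
  ⟨thm1Printed_steer F G x, cor3_250_steer F G x⟩

variable (av : (K j : ℕ) → Averaging (F.P K) j G)

/-- **THE TUNED BARE-COUPLING SEQUENCES OF THE STEERED DATUM ARE PRESCRIBED**: for `0 < g ≤ γ`,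
`D.Tuned γ g g₀ ↔ ∀ K, g₀ K = g · x K` — the renormalisation conditions of [Balaban1987RG1] Thm 2 («g_k ∈ ]0, γ], g_K = g») select EXACTLY
the bare couplings `g · x_K` at this datum. [folklore] -/
theorem tuned_steer_iff (hx0 : x 0 = 1) (hxpos : ∀ k, 0 < x k) (hanti : Antitone x)
    (hmeas : ∀ K j, Measurable (av K j).avg) (hac : ∀ K k, k < K → HaarAC (av K k).avg)
    {γ g : ℝ} (hg : 0 < g) (hgγ : g ≤ γ) (g₀ : ℕ → ℝ) :
    (steerData F G x av hx0 hxpos hmeas hac).Tuned γ g g₀ ↔ ∀ K, g₀ K = g * x K := by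
  constructor
  · intro h K
    have hK := (h K).2
    change g₀ K / x K = g at hK
    rwa [div_eq_iff (hxpos K).ne'] at hK
  · intro h K
    refine ⟨fun k hk => ?_, ?_⟩
    · change 0 < g₀ K / x k ∧ g₀ K / x k ≤ γ
      rw [h K]
      exact ⟨(steer_run_mem x hxpos hanti hg hk).1, (steer_run_mem x hxpos hanti hg hk).2.trans hgγ⟩
    · change g₀ K / x K = g
      rw [h K]
      exact mul_div_cancel_right₀ g (hxpos K).ne'

/-- Tuned sequences force `g ≤ γ` (the endpoint lies in the window). [folklore] -/
theorem le_of_tuned_steer (hx0 : x 0 = 1) (hxpos : ∀ k, 0 < x k)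
    (hmeas : ∀ K j, Measurable (av K j).avg) (hac : ∀ K k, k < K → HaarAC (av K k).avg)
    {γ g : ℝ} {g₀ : ℕ → ℝ} (h : (steerData F G x av hx0 hxpos hmeas hac).Tuned γ g g₀) : g ≤ γ := by
  obtain ⟨hI, hK⟩ := h 0
  have := (hI 0 le_rfl).2
  change g₀ 0 / x 0 ≤ γ at this
  change g₀ 0 / x 0 = g at hK
  rwa [hK] at this

end JunkTrue

/-! ## 4. At `SU(N)` with the averaging of record: the spine's ∃-face follows from hybrid-NE7 data along ANY antitone steer -/

section Record

open Literature.MathematicalPhysics.QuantumFieldTheory.Balaban1983to89.Node00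
open Literature.MathematicalPhysics.QuantumFieldTheory.Balaban1983to89.T4ContinuumYM4Torus (ForSmallCouplings)

variable (F : T4Family) (N : ℕ) [NeZero N] (x : ℕ → ℝ) (hx0 : x 0 = 1) (hxpos : ∀ k, 0 < x k)

/-- THE STEERED DATUM OF RECORD (Stage 0): the steered datum driven by Bałaban's averaging of record on `SU(N)`.  JUNK beyond `av`. [folklore] -/
def steerDatumSU : FiniteEpsData F (Matrix.specialUnitaryGroup (Fin N) ℂ) :=
  steerData F (Matrix.specialUnitaryGroup (Fin N) ℂ) x (avOfRecord F N) hx0 hxpos (avOfRecord_measurable F N)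
    (avOfRecord_haarAC F N)

/-- It IS a datum of record, Stage 0 (`rfl`: the predicate reads `D.av` only). [folklore] -/
theorem isDatumOfRecord₀_steerDatumSU : IsDatumOfRecord₀ F N (steerDatumSU F N x hx0 hxpos) := rfl

/-- (B) as typed holds at it. [folklore] -/
theorem endStatementBPrinted_steerDatumSU : B16.EndStatementBPrinted (steerDatumSU F N x hx0 hxpos).C :=
  endStatementBPrinted_steer F _ x

/-- Endpoint existence as typed holds at it (antitone steer). [folklore] -/
theorem endpointExistence_steerDatumSU (hanti : Antitone x) :
    DagBinding.EndpointExistence (steerDatumSU F N x hx0 hxpos).C.toB12 :=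
  endpointExistence_steer F _ x hxpos hanti

/-- Its Wilson scheme is the scheme of EVERY Stage-0 datum of record of the family (schemes read `av` only; via the flat datum's
`scheme_flatDatumSU_eq`). [folklore] -/
theorem scheme_steerDatumSU_eq (D : FiniteEpsData F (Matrix.specialUnitaryGroup (Fin N) ℂ)) (hD : IsDatumOfRecord₀ F N D)
    (g₀ : ℕ → ℝ) : (steerDatumSU F N x hx0 hxpos).scheme g₀ = D.scheme g₀ :=
  (scheme_flatDatumSU_eq F N _ (isDatumOfRecord₀_steerDatumSU F N x hx0 hxpos) g₀).symm.trans
    (scheme_flatDatumSU_eq F N D hD g₀)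

/-- Along a tuned sequence of the steered datum the scheme's inverse couplings are `β_K = (g · x_K)⁻²` — growing as fast as `x` decays. [folklore] -/
theorem scheme_β_steer (g : ℝ) (K : ℕ) :
    ((steerDatumSU F N x hx0 hxpos).scheme fun K => g * x K).β K = (g * x K)⁻¹ ^ 2 := rfl

/-- **THE SPINE SLOT AT THE STEERED DATUM, UNFOLDED**: for any β-side hypothesis `H`, `T4ApexHybrid.HybridNE7Under D H` at the steered datum of
record is EQUIVALENT to «`H →` there are `γ₀ > 0` and, for every `γ ∈ ]0, γ₀]`, a `g₁ > 0` such that for every `g ∈ ]0, g₁]` with `g ≤ γ`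
the Wilson scheme of record at bare couplings `g · x_K` carries per-string hybrid-NE7 data» — (B) is discharged by the junk fields and the
∀ over tuned sequences collapses to the ONE prescribed sequence (`tuned_steer_iff`). [folklore] -/
theorem hybridNE7Under_steer_iff (hanti : Antitone x) (H : Prop) :
    T4ApexHybrid.HybridNE7Under (steerDatumSU F N x hx0 hxpos) H ↔
      (H → ∃ γ₀ : ℝ, 0 < γ₀ ∧ ∀ γ : ℝ, 0 < γ → γ ≤ γ₀ → ∃ g₁ : ℝ, 0 < g₁ ∧ ∀ g : ℝ, 0 < g → g ≤ g₁ → g ≤ γ →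
        T4ApexHybrid.StringwiseHybridNE7 ((steerDatumSU F N x hx0 hxpos).scheme fun K => g * x K)) := by
  have hB := endStatementBPrinted_steerDatumSU F N x hx0 hxpos
  have htuned : ∀ {γ g : ℝ}, 0 < g → g ≤ γ → ∀ g₀ : ℕ → ℝ,
      (steerDatumSU F N x hx0 hxpos).Tuned γ g g₀ ↔ ∀ K, g₀ K = g * x K := fun hg hgγ g₀ =>
    tuned_steer_iff F _ x (avOfRecord F N) hx0 hxpos hanti (avOfRecord_measurable F N) (avOfRecord_haarAC F N) hg hgγ g₀
  unfold T4ApexHybrid.HybridNE7Under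
  rw [T4ContinuumYM4Torus.underHypotheses_iff]
  constructor
  · intro h hH
    obtain ⟨γ₀, hγ₀, hγ⟩ := h hB hH
    refine ⟨γ₀, hγ₀, fun γ hγpos hγle => ?_⟩
    obtain ⟨g₁, hg₁, hg⟩ := hγ γ hγpos hγle
    exact ⟨g₁, hg₁, fun g hgpos hgle hgγ => hg g hgpos hgle _ ((htuned hgpos hgγ _).mpr fun _ => rfl)⟩
  · intro h _ hH
    obtain ⟨γ₀, hγ₀, hγ⟩ := h hH
    refine ⟨γ₀, hγ₀, fun γ hγpos hγle => ?_⟩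
    obtain ⟨g₁, hg₁, hg⟩ := hγ γ hγpos hγle
    refine ⟨g₁, hg₁, fun g hgpos hgle g₀ ht => ?_⟩
    have hgγ : g ≤ γ :=
      le_of_tuned_steer F _ x (avOfRecord F N) hx0 hxpos (avOfRecord_measurable F N) (avOfRecord_haarAC F N) ht
    have hg₀ : g₀ = fun K => g * x K := funext ((htuned hgpos hgγ g₀).mp ht)
    rw [hg₀]
    exact hg g hgpos hgle hgγ

/-- **KERNEL WITNESS №3 — THE SPINE'S ∃-FACE OVER STAGE 0 FOLLOWS FROM HYBRID-NE7 DATA ALONG ANY ANTITONE STEER**: if the family's Wilson scheme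
of record (Bałaban's averaging (0.4) on `SU(N)`, Wilson weights at bare couplings `g · x_K`) carries per-string hybrid-NE7 data for all small
`γ`, `g ≤ γ`, where `x` is ANY antitone positive profile with `x 0 = 1`, then SOME datum of record (Stage 0) satisfies (B) as typed, endpoint
existence as typed AND the spine slot `HybridNE7Under D (EndpointExistence …)` — namely the steered datum.  At `N = 2` the conclusion is
VERBATIM the matrix of the spine leaf `Summit.QuantumFields.YangMills.Theses.BalabanLadder.UV F` (item stmt-QuantumFields-19351) and the
conclusion of the detail route's crux `SpineGivenEndpoint F` (stmt-QuantumFields-19182), which this module does not import or name.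
NEGATIVE INFORMATION: the leaf as typed lets the prover choose the coupling trajectory — e.g. `x_K := 2^{−2^K}`, inverse couplings
`β_K = 4^{2^K}∕g²`, for which the matching clause concerns Wilson measures ever more concentrated at flat connections on the tori `F.P K`,
not Bałaban's asymptotically-free runs; whether such steered matching is provable is NOT claimed here. [folklore] -/
theorem exists_isDatumOfRecord₀_B_end_hybrid_of_steer (hanti : Antitone x)
    (h : ∃ γ₀ : ℝ, 0 < γ₀ ∧ ∀ γ : ℝ, 0 < γ → γ ≤ γ₀ → ∃ g₁ : ℝ, 0 < g₁ ∧ ∀ g : ℝ, 0 < g → g ≤ g₁ → g ≤ γ →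
      T4ApexHybrid.StringwiseHybridNE7 ((steerDatumSU F N x hx0 hxpos).scheme fun K => g * x K)) :
    ∃ D : FiniteEpsData F (Matrix.specialUnitaryGroup (Fin N) ℂ), IsDatumOfRecord₀ F N D ∧ B16.EndStatementBPrinted D.C ∧
      DagBinding.EndpointExistence D.C.toB12 ∧ T4ApexHybrid.HybridNE7Under D (DagBinding.EndpointExistence D.C.toB12) :=
  ⟨steerDatumSU F N x hx0 hxpos, isDatumOfRecord₀_steerDatumSU F N x hx0 hxpos, endStatementBPrinted_steerDatumSU F N x hx0 hxpos,
    endpointExistence_steerDatumSU F N x hx0 hxpos hanti, (hybridNE7Under_steer_iff F N x hx0 hxpos hanti _).mpr fun _ => h⟩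

/-- **CONVERSELY, WHAT THE ∃-FACE GIVES BACK AT THE STEERED DATUM**: if the steered datum itself witnesses the face, the family's Wilson scheme of
record carries hybrid-NE7 data along the steer — so AT THIS WITNESS the face says exactly that and nothing about Bałaban's runs. [folklore] -/
theorem stringwiseHybridNE7_steer_of_hybridNE7Under (hanti : Antitone x)
    (h : T4ApexHybrid.HybridNE7Under (steerDatumSU F N x hx0 hxpos)
      (DagBinding.EndpointExistence (steerDatumSU F N x hx0 hxpos).C.toB12)) :
    ∃ γ₀ : ℝ, 0 < γ₀ ∧ ∀ γ : ℝ, 0 < γ → γ ≤ γ₀ → ∃ g₁ : ℝ, 0 < g₁ ∧ ∀ g : ℝ, 0 < g → g ≤ g₁ → g ≤ γ →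
      T4ApexHybrid.StringwiseHybridNE7 ((steerDatumSU F N x hx0 hxpos).scheme fun K => g * x K) :=
  (hybridNE7Under_steer_iff F N x hx0 hxpos hanti _).mp h (endpointExistence_steerDatumSU F N x hx0 hxpos hanti)

/-- **A FAST STEER EXISTS** (so №3 is not about an empty class of profiles): `x_K := (2^K)⁻¹` is antitone, positive, `x 0 = 1`; along it the
tuned inverse couplings are `β_K = 4^K ∕ g²`.  (Any positive antitone profile with `x 0 = 1` is admissible — doubly-exponential ones included.) [folklore] -/
theorem exists_fast_steer : ∃ x : ℕ → ℝ, x 0 = 1 ∧ (∀ k, 0 < x k) ∧ Antitone x ∧ ∀ k, x k = ((2 : ℝ) ^ k)⁻¹ :=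
  ⟨fun k => ((2 : ℝ) ^ k)⁻¹, by simp, fun k => by positivity,
    fun a b hab => by
      dsimp only
      exact inv_anti₀ (by positivity) (pow_le_pow_right₀ one_le_two hab),
    fun _ => rfl⟩

end Record

end Summit.QuantumFields.YangMills.Theorems.BalabanUVNodesStage0SteeredWitness

end
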